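import Summits.QuantumFields.YangMills.Theorems.UnitScaleTiltProp7CurrentPairingBound
import HarnessLib

/-!
# Route `UnitScaleTilt`, crux K1 «MinimiserStabilityRegPr» (stmt-QuantumFields-19200), route-R E′ growth side, ℛ-line, J-ROW★ curved — brick B-J5 DOOR «J-ROW★ FROM THE CURL
# ROW OF THE ν-SUMMED CURRENT FIELD»: at ANY unitary background with `‖U(∂p) − 1‖ ≤ a`, if a bond field `B` EQUAL to the ν-summed CURRENT field of `φ` has
# `Σ_{x,μ<ν}|curl_U B|²_HS ≤ ρ·CUR(φ) + e_K·K(φ) + e_M·M(φ)` (the curl row (α) of LOCATE v4.1∕v4.2 §§4–5), then `w·CUR(φ) ≤ C_J·K(φ) + C′·a²·M(φ)` — J-ROW★ in the TEXT of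
# ✓ `Prop7RRowOfJRow.RRow_of_JRow`'s hypothesis `hJ` — with `C_J = w·(s·e_K + s⁻¹ + 32a²d)`, `C′ = w·(s·e_M∕a² + 16d²)` for any `s > 0` with `2sρ ≤ 1`

Cell `ym3-torus`, width seat `ym3-torus-px19` (gen 5).  WHERE IT SITS: ✓p685538 `Prop7CurrentPairingBound.current_pairing_le` is the `B`-generic half of J-ROW★'s elementary
inhabitant (LOCATE v4, HOME `ym-ust-19200-w4/g7/LOCATE-JROW-CURVED-V4-w4g7.md`); its docstring: «B-J5 reads it with `B` = the current commutator field, `s ≍ ℓ∕√C`, `θ ≍ ℓ²`».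
THIS FILE IS THAT READING: test the identity with `B := CUR`-field, book the `θ·d·Σ|B|²` slot as `θ·d·CUR`, take `θ := (4ad)⁻¹`, absorb, and solve for `CUR`.  What remains
DISPLAYED is the ONE curl row (α) (bricks B-J2 «curl of a commutator-current field» and B-J3 «covariant transpose on a block + its curl» supply it at an R2-critical background
with their own `ρ ≍ c∕ℓ²`, `e_K`, `e_M`); downstream ✓ `RRow_of_JRow` (ℛ-ROW★) → ✓ `RRow_T3_of_JRow` → ✓p678151 hKg-K are kernel-composed already, and §3 below certifies the
first link from (α) by `exact`.  Background-generic (no `IsCritR2`, no T³ member letters).  THEOREMS ONLY (0 `def`, 0 `sorry`); `--supports stmt-QuantumFields-19200`,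
count-neutral.  YM₃ on T³ is a ladder rung (R3), not the Clay problem; nothing here claims (α), J-ROW★ at `IsCritR2`, hKg-K, S3, E′, a stub, the crux, d = 4 or the mass gap.

LETTERS (✓p684887 VERBATIM: `B9Eq39Adjoint` `R covD curl plaqU` on `torusT P i`, unitary units-valued `U`, Hilbert–Schmidt sizes `Σ_jk‖X_jk‖²`):
`K(φ) = Σ_xΣ_μΣ_ν[μ<ν]Σ_jk‖(curl_U D_Uφ)_{μν}(x)_jk‖²`, `M(φ) = Σ_xΣ_μΣ_jk‖(D_{U,μ}φ)(x)_jk‖²`, `CUR(φ) = Σ_xΣ_μΣ_jk‖(Σ_ν CURRENT_{νμ}(x))_jk‖²`, and for the test field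
`CURLB(B) = Σ_xΣ_μΣ_ν[μ<ν]Σ_jk‖(curl_U B)_{μν}(x)_jk‖²`.

WHAT IS PROVED (ns `…Theorems.Prop7JRowOfCurlRow`).
* §1 ★★ `cur_le_of_curlRow` — `B = CUR`-field, (α) with free reals `ρ e_K e_M`, free `s θ > 0` in the absorption window `s·ρ + 2·a·θ·d ≤ 1` ⟹
  `CUR(φ) ≤ (s·e_K + s⁻¹ + 8·a·θ⁻¹)·K(φ) + (s·e_M + 4·a·d·θ⁻¹)·M(φ)`.
* §2 ★★★ `JRow_of_curlRow` — `0 < a`, `0 < d`, `0 < w`, `0 < s`, `2sρ ≤ 1`, (α) ⟹ `w·CUR(φ) ≤ (w·(s·e_K + s⁻¹ + 32·a²·d))·K(φ) + (w·(s·e_M∕a² + 16·d²))·a²·M(φ)` — ✓ `RRow_of_JRow`'s `hJ`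
  text with these `C_J`, `C′` (`θ := (4ad)⁻¹`).  At `w = ℓ²`, `s = ℓ²∕(4c)`, `ρ = c∕ℓ² + O(a²)`, `e_K = O(a² + |J|_∞²)`, `e_M = O(|J|_∞²)` (LOCATE v4.2 §5): `C_J = 4c + O(e² + ε₀²)`,
  `C′ = O(ℓ²·(d² + (ε₀∕e)²))` — the LOCATE's «`C_J` ABSOLUTE, `C′` allowed to be `O(ℓ²)`».
* §3 ★★ `RRow_of_curlRow` — E2E BY KERNEL: (α) ∧ `16a ≤ 1` ∧ `0 ≤ e_K` ⟹ ℛ-ROW★ `w·K(φ) ≤ (2C_J + C′a²w∕(2C_J) + 6d·a·w)·M(φ)` (= ✓ `RRow_of_JRow` ∘ §2, one `exact`).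
HONEST SCOPE.  `linarith` bookkeeping over ✓p685538 and ✓p684887; no estimate on `curl_U B` (that is (α) = B-J2∕B-J3, DISPLAYED); no claim that (α) holds at `IsCritR2`.

References: T. Bałaban, CMP 99 (1985) 389–434 [Balaban1985BackgroundPropagators] ((3.3)–(3.4) pp.390–391, (3.9) p.392); CMP 102 (1985) 277–309 [Balaban1985Variational]
((135) p.298, Prop. 7 p.299).
-/

set_option autoImplicit false

noncomputable section

open scoped BigOperators Matrix.Norms.L2Operator Matrix

namespace Summit.QuantumFields.YangMills.Theorems.Prop7JRowOfCurlRow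

open Literature.MathematicalPhysics.QuantumFieldTheory.Balaban1983to89
open B9Eq39Adjoint (R covD covDstar curl plaqU)
open B9TorusCalculus (torusT)
open Summit.QuantumFields.YangMills.Theorems.Prop7CovariantCoercivity (re_trace_conjTranspose_mul_self)
open Summit.QuantumFields.YangMills.Theorems.Prop7CurrentPairingBound (current_pairing_le)
open Summit.QuantumFields.YangMills.Theorems.Prop7RRowOfJRow (RRow_of_JRow)

variable {P : Params} {i : ℕ} {N : ℕ} (U : Fin P.d → Site P i → (Matrix (Fin N) (Fin N) ℂ)ˣ)

/-! ## §1 The current pairing read at `B := CUR`-field, absorbed -/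

/-- ★★ **`CUR` FROM THE CURL ROW OF THE CURRENT FIELD (free weights).**  Unitary background, `‖U(∂p) − 1‖ ≤ a`, `0 ≤ a`; site field `φ`; a bond field `B` EQUAL to the ν-summed
CURRENT field of `φ` (the summand of `CUR` in ✓ `RRow_of_JRow`, verbatim); reals `ρ e_K e_M`, `0 < s`, `0 < θ` with the absorption window `s·ρ + 2·a·θ·d ≤ 1`.  IF the curl
row (α) `CURLB(B) ≤ ρ·CUR(φ) + e_K·K(φ) + e_M·M(φ)` holds THEN `CUR(φ) ≤ (s·e_K + s⁻¹ + 8·a·θ⁻¹)·K(φ) + (s·e_M + 4·a·d·θ⁻¹)·M(φ)`.  Proof: ✓ `current_pairing_le` at this `B`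
(its left side and its `θ·d·Σ|B|²` slot are `CUR` by `Re tr(XᴴX) = Σ|X_jk|²`), then `linarith`. [cite: Balaban1985BackgroundPropagators, (3.9) p.392; Balaban1985Variational, (135) p.298, Prop. 7 p.299] -/
theorem cur_le_of_curlRow [NeZero N] (hU : ∀ (ν : Fin P.d) (x : Site P i), (U ν x : Matrix (Fin N) (Fin N) ℂ) ∈ unitary (Matrix (Fin N) (Fin N) ℂ))
    {a : ℝ} (ha0 : 0 ≤ a) (ha : ∀ (μ ν : Fin P.d) (x : Site P i), ‖(plaqU (torusT P i) U μ ν x : Matrix (Fin N) (Fin N) ℂ) - 1‖ ≤ a)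
    (φ : Site P i → Matrix (Fin N) (Fin N) ℂ) (B : Fin P.d → Site P i → Matrix (Fin N) (Fin N) ℂ)
    (hB : ∀ (μ : Fin P.d) (x : Site P i), B μ x = ∑ ν : Fin P.d,
            (R ((U ν (x.unshift ν))⁻¹ * plaqU (torusT P i) U ν μ (x.unshift ν) * U ν (x.unshift ν))
                  (R (U ν (x.unshift ν))⁻¹ (R (U μ (x.unshift ν) * U ν ((x.unshift ν).shift μ)) (φ (((x.unshift ν).shift μ).shift ν))))
              - R (plaqU (torusT P i) U ν μ x)
                  (R (U ν (x.unshift ν))⁻¹ (R (U μ (x.unshift ν) * U ν ((x.unshift ν).shift μ)) (φ (((x.unshift ν).shift μ).shift ν))))))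
    {ρ eK eM s θ : ℝ} (hs : 0 < s) (hθ : 0 < θ) (hwin : s * ρ + 2 * a * θ * P.d ≤ 1)
    (hα : ∑ x : Site P i, ∑ μ : Fin P.d, ∑ ν : Fin P.d, (if μ < ν then
        ∑ j : Fin N, ∑ k : Fin N, ‖(curl (torusT P i) U B μ ν x) j k‖ ^ 2 else 0)
      ≤ ρ * ∑ x : Site P i, ∑ μ : Fin P.d, ∑ j : Fin N, ∑ k : Fin N,
        ‖(∑ ν : Fin P.d,
            (R ((U ν (x.unshift ν))⁻¹ * plaqU (torusT P i) U ν μ (x.unshift ν) * U ν (x.unshift ν))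
                  (R (U ν (x.unshift ν))⁻¹ (R (U μ (x.unshift ν) * U ν ((x.unshift ν).shift μ)) (φ (((x.unshift ν).shift μ).shift ν))))
              - R (plaqU (torusT P i) U ν μ x)
                  (R (U ν (x.unshift ν))⁻¹ (R (U μ (x.unshift ν) * U ν ((x.unshift ν).shift μ)) (φ (((x.unshift ν).shift μ).shift ν)))))) j k‖ ^ 2
        + eK * ∑ x : Site P i, ∑ μ : Fin P.d, ∑ ν : Fin P.d, (if μ < ν then
        ∑ j : Fin N, ∑ k : Fin N, ‖(curl (torusT P i) U (fun κ => covD (torusT P i) U κ φ) μ ν x) j k‖ ^ 2 else 0)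
        + eM * ∑ x : Site P i, ∑ μ : Fin P.d, ∑ j : Fin N, ∑ k : Fin N, ‖(covD (torusT P i) U μ φ x) j k‖ ^ 2) :
    ∑ x : Site P i, ∑ μ : Fin P.d, ∑ j : Fin N, ∑ k : Fin N,
        ‖(∑ ν : Fin P.d,
            (R ((U ν (x.unshift ν))⁻¹ * plaqU (torusT P i) U ν μ (x.unshift ν) * U ν (x.unshift ν))
                  (R (U ν (x.unshift ν))⁻¹ (R (U μ (x.unshift ν) * U ν ((x.unshift ν).shift μ)) (φ (((x.unshift ν).shift μ).shift ν))))
              - R (plaqU (torusT P i) U ν μ x)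
                  (R (U ν (x.unshift ν))⁻¹ (R (U μ (x.unshift ν) * U ν ((x.unshift ν).shift μ)) (φ (((x.unshift ν).shift μ).shift ν)))))) j k‖ ^ 2
      ≤ (s * eK + s⁻¹ + 8 * a * θ⁻¹) * ∑ x : Site P i, ∑ μ : Fin P.d, ∑ ν : Fin P.d, (if μ < ν then
        ∑ j : Fin N, ∑ k : Fin N, ‖(curl (torusT P i) U (fun κ => covD (torusT P i) U κ φ) μ ν x) j k‖ ^ 2 else 0)
        + (s * eM + 4 * a * P.d * θ⁻¹) * ∑ x : Site P i, ∑ μ : Fin P.d, ∑ j : Fin N, ∑ k : Fin N, ‖(covD (torusT P i) U μ φ x) j k‖ ^ 2 := by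
  -- ✓ `current_pairing_le` at this `B`
  have h := current_pairing_le U hU ha0 ha φ B hs hθ
  -- the test field IS the current field: its two `B`-slots become `CUR`
  have hBB : ∀ (x : Site P i) (μ : Fin P.d), ∑ j : Fin N, ∑ k : Fin N, ‖(B μ x) j k‖ ^ 2 = ∑ j : Fin N, ∑ k : Fin N,
        ‖(∑ ν : Fin P.d,
            (R ((U ν (x.unshift ν))⁻¹ * plaqU (torusT P i) U ν μ (x.unshift ν) * U ν (x.unshift ν))
                  (R (U ν (x.unshift ν))⁻¹ (R (U μ (x.unshift ν) * U ν ((x.unshift ν).shift μ)) (φ (((x.unshift ν).shift μ).shift ν))))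
              - R (plaqU (torusT P i) U ν μ x)
                  (R (U ν (x.unshift ν))⁻¹ (R (U μ (x.unshift ν) * U ν ((x.unshift ν).shift μ)) (φ (((x.unshift ν).shift μ).shift ν)))))) j k‖ ^ 2 := by
    intro x μ
    rw [hB μ x]
  have hLHS : ∑ x : Site P i, ∑ μ : Fin P.d, (((B μ x)ᴴ * ∑ ν : Fin P.d,
            (R ((U ν (x.unshift ν))⁻¹ * plaqU (torusT P i) U ν μ (x.unshift ν) * U ν (x.unshift ν))
                  (R (U ν (x.unshift ν))⁻¹ (R (U μ (x.unshift ν) * U ν ((x.unshift ν).shift μ)) (φ (((x.unshift ν).shift μ).shift ν))))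
              - R (plaqU (torusT P i) U ν μ x)
                  (R (U ν (x.unshift ν))⁻¹ (R (U μ (x.unshift ν) * U ν ((x.unshift ν).shift μ)) (φ (((x.unshift ν).shift μ).shift ν)))))).trace).re
      = ∑ x : Site P i, ∑ μ : Fin P.d, ∑ j : Fin N, ∑ k : Fin N,
        ‖(∑ ν : Fin P.d,
            (R ((U ν (x.unshift ν))⁻¹ * plaqU (torusT P i) U ν μ (x.unshift ν) * U ν (x.unshift ν))
                  (R (U ν (x.unshift ν))⁻¹ (R (U μ (x.unshift ν) * U ν ((x.unshift ν).shift μ)) (φ (((x.unshift ν).shift μ).shift ν))))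
              - R (plaqU (torusT P i) U ν μ x)
                  (R (U ν (x.unshift ν))⁻¹ (R (U μ (x.unshift ν) * U ν ((x.unshift ν).shift μ)) (φ (((x.unshift ν).shift μ).shift ν)))))) j k‖ ^ 2 := by
    refine Finset.sum_congr rfl fun x _ => Finset.sum_congr rfl fun μ _ => ?_
    rw [hB μ x, re_trace_conjTranspose_mul_self]
  have hBsum : ∑ x : Site P i, ∑ μ : Fin P.d, ∑ j : Fin N, ∑ k : Fin N, ‖(B μ x) j k‖ ^ 2
      = ∑ x : Site P i, ∑ μ : Fin P.d, ∑ j : Fin N, ∑ k : Fin N,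
        ‖(∑ ν : Fin P.d,
            (R ((U ν (x.unshift ν))⁻¹ * plaqU (torusT P i) U ν μ (x.unshift ν) * U ν (x.unshift ν))
                  (R (U ν (x.unshift ν))⁻¹ (R (U μ (x.unshift ν) * U ν ((x.unshift ν).shift μ)) (φ (((x.unshift ν).shift μ).shift ν))))
              - R (plaqU (torusT P i) U ν μ x)
                  (R (U ν (x.unshift ν))⁻¹ (R (U μ (x.unshift ν) * U ν ((x.unshift ν).shift μ)) (φ (((x.unshift ν).shift μ).shift ν)))))) j k‖ ^ 2 :=
    Finset.sum_congr rfl fun x _ => Finset.sum_congr rfl fun μ _ => hBB x μ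
  rw [hLHS, hBsum] at h
  -- letters
  set K : ℝ := ∑ x : Site P i, ∑ μ : Fin P.d, ∑ ν : Fin P.d, (if μ < ν then
        ∑ j : Fin N, ∑ k : Fin N, ‖(curl (torusT P i) U (fun κ => covD (torusT P i) U κ φ) μ ν x) j k‖ ^ 2 else 0) with hK
  set M : ℝ := ∑ x : Site P i, ∑ μ : Fin P.d, ∑ j : Fin N, ∑ k : Fin N, ‖(covD (torusT P i) U μ φ x) j k‖ ^ 2 with hM
  set CUR : ℝ := ∑ x : Site P i, ∑ μ : Fin P.d, ∑ j : Fin N, ∑ k : Fin N,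
        ‖(∑ ν : Fin P.d,
            (R ((U ν (x.unshift ν))⁻¹ * plaqU (torusT P i) U ν μ (x.unshift ν) * U ν (x.unshift ν))
                  (R (U ν (x.unshift ν))⁻¹ (R (U μ (x.unshift ν) * U ν ((x.unshift ν).shift μ)) (φ (((x.unshift ν).shift μ).shift ν))))
              - R (plaqU (torusT P i) U ν μ x)
                  (R (U ν (x.unshift ν))⁻¹ (R (U μ (x.unshift ν) * U ν ((x.unshift ν).shift μ)) (φ (((x.unshift ν).shift μ).shift ν)))))) j k‖ ^ 2 with hCUR
  set CB : ℝ := ∑ x : Site P i, ∑ μ : Fin P.d, ∑ ν : Fin P.d, (if μ < ν then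
        ∑ j : Fin N, ∑ k : Fin N, ‖(curl (torusT P i) U B μ ν x) j k‖ ^ 2 else 0) with hCB
  have hCUR0 : 0 ≤ CUR := by
    rw [hCUR]; exact Finset.sum_nonneg fun _ _ => Finset.sum_nonneg fun _ _ => Finset.sum_nonneg fun _ _ => Finset.sum_nonneg fun _ _ => sq_nonneg _
  clear_value K M CUR CB
  -- substitute (α) in the `s∕2`-slot and absorb `(sρ∕2 + aθd)·CUR ≤ CUR∕2`
  have h1 : s / 2 * CB ≤ s / 2 * (ρ * CUR + eK * K + eM * M) := mul_le_mul_of_nonneg_left hα (by positivity)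
  have h2 : CUR * (s * ρ + 2 * a * θ * P.d) ≤ CUR * 1 := mul_le_mul_of_nonneg_left hwin hCUR0
  have hθi : θ * θ⁻¹ = 1 := mul_inv_cancel₀ hθ.ne'
  nlinarith [h, h1, h2, hθi, hCUR0, hθ, hs, ha0]

/-! ## §2 ★★★ J-ROW★ in ✓ `RRow_of_JRow`'s `hJ` text -/

/-- ★★★ **J-ROW★ FROM THE CURL ROW OF THE CURRENT FIELD.**  Unitary background with `‖U(∂p) − 1‖ ≤ a`, `0 < a`, `0 < d`; site field `φ`; `B` = the ν-summed CURRENT field of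
`φ`; reals `ρ e_K e_M`, `0 < w`, `0 < s` with `2·s·ρ ≤ 1`.  IF (α) `CURLB(B) ≤ ρ·CUR(φ) + e_K·K(φ) + e_M·M(φ)` THEN
`w·CUR(φ) ≤ (w·(s·e_K + s⁻¹ + 32·a²·d))·K(φ) + (w·(s·e_M∕a² + 16·d²))·a²·M(φ)` — the hypothesis `hJ` of ✓ `RRow_of_JRow` with `C_J := w·(s·e_K + s⁻¹ + 32a²d)`,
`C′ := w·(s·e_M∕a² + 16d²)`.  Proof: §1 at `θ := (4ad)⁻¹`. [cite: Balaban1985BackgroundPropagators, (3.9) p.392; Balaban1985Variational, (135) p.298, Prop. 7 p.299] -/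
theorem JRow_of_curlRow [NeZero N] (hU : ∀ (ν : Fin P.d) (x : Site P i), (U ν x : Matrix (Fin N) (Fin N) ℂ) ∈ unitary (Matrix (Fin N) (Fin N) ℂ))
    {a : ℝ} (hapos : 0 < a) (ha : ∀ (μ ν : Fin P.d) (x : Site P i), ‖(plaqU (torusT P i) U μ ν x : Matrix (Fin N) (Fin N) ℂ) - 1‖ ≤ a) (hd : 0 < P.d)
    (φ : Site P i → Matrix (Fin N) (Fin N) ℂ) (B : Fin P.d → Site P i → Matrix (Fin N) (Fin N) ℂ)
    (hB : ∀ (μ : Fin P.d) (x : Site P i), B μ x = ∑ ν : Fin P.d,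
            (R ((U ν (x.unshift ν))⁻¹ * plaqU (torusT P i) U ν μ (x.unshift ν) * U ν (x.unshift ν))
                  (R (U ν (x.unshift ν))⁻¹ (R (U μ (x.unshift ν) * U ν ((x.unshift ν).shift μ)) (φ (((x.unshift ν).shift μ).shift ν))))
              - R (plaqU (torusT P i) U ν μ x)
                  (R (U ν (x.unshift ν))⁻¹ (R (U μ (x.unshift ν) * U ν ((x.unshift ν).shift μ)) (φ (((x.unshift ν).shift μ).shift ν))))))
    {ρ eK eM w s : ℝ} (hw : 0 < w) (hs : 0 < s) (hsρ : 2 * s * ρ ≤ 1)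
    (hα : ∑ x : Site P i, ∑ μ : Fin P.d, ∑ ν : Fin P.d, (if μ < ν then
        ∑ j : Fin N, ∑ k : Fin N, ‖(curl (torusT P i) U B μ ν x) j k‖ ^ 2 else 0)
      ≤ ρ * ∑ x : Site P i, ∑ μ : Fin P.d, ∑ j : Fin N, ∑ k : Fin N,
        ‖(∑ ν : Fin P.d,
            (R ((U ν (x.unshift ν))⁻¹ * plaqU (torusT P i) U ν μ (x.unshift ν) * U ν (x.unshift ν))
                  (R (U ν (x.unshift ν))⁻¹ (R (U μ (x.unshift ν) * U ν ((x.unshift ν).shift μ)) (φ (((x.unshift ν).shift μ).shift ν))))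
              - R (plaqU (torusT P i) U ν μ x)
                  (R (U ν (x.unshift ν))⁻¹ (R (U μ (x.unshift ν) * U ν ((x.unshift ν).shift μ)) (φ (((x.unshift ν).shift μ).shift ν)))))) j k‖ ^ 2
        + eK * ∑ x : Site P i, ∑ μ : Fin P.d, ∑ ν : Fin P.d, (if μ < ν then
        ∑ j : Fin N, ∑ k : Fin N, ‖(curl (torusT P i) U (fun κ => covD (torusT P i) U κ φ) μ ν x) j k‖ ^ 2 else 0)
        + eM * ∑ x : Site P i, ∑ μ : Fin P.d, ∑ j : Fin N, ∑ k : Fin N, ‖(covD (torusT P i) U μ φ x) j k‖ ^ 2) :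
    w * ∑ x : Site P i, ∑ μ : Fin P.d, ∑ j : Fin N, ∑ k : Fin N,
        ‖(∑ ν : Fin P.d,
            (R ((U ν (x.unshift ν))⁻¹ * plaqU (torusT P i) U ν μ (x.unshift ν) * U ν (x.unshift ν))
                  (R (U ν (x.unshift ν))⁻¹ (R (U μ (x.unshift ν) * U ν ((x.unshift ν).shift μ)) (φ (((x.unshift ν).shift μ).shift ν))))
              - R (plaqU (torusT P i) U ν μ x)
                  (R (U ν (x.unshift ν))⁻¹ (R (U μ (x.unshift ν) * U ν ((x.unshift ν).shift μ)) (φ (((x.unshift ν).shift μ).shift ν)))))) j k‖ ^ 2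
      ≤ (w * (s * eK + s⁻¹ + 32 * a ^ 2 * P.d)) * ∑ x : Site P i, ∑ μ : Fin P.d, ∑ ν : Fin P.d, (if μ < ν then
        ∑ j : Fin N, ∑ k : Fin N, ‖(curl (torusT P i) U (fun κ => covD (torusT P i) U κ φ) μ ν x) j k‖ ^ 2 else 0)
        + (w * (s * eM / a ^ 2 + 16 * (P.d : ℝ) ^ 2)) * a ^ 2
          * ∑ x : Site P i, ∑ μ : Fin P.d, ∑ j : Fin N, ∑ k : Fin N, ‖(covD (torusT P i) U μ φ x) j k‖ ^ 2 := by
  have hdR : (0 : ℝ) < P.d := by exact_mod_cast hd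
  -- §1 at `θ := (4ad)⁻¹`
  have hθ : (0 : ℝ) < (4 * a * P.d)⁻¹ := by positivity
  have hwin : s * ρ + 2 * a * (4 * a * P.d)⁻¹ * P.d ≤ 1 := by
    have e : 2 * a * (4 * a * (P.d : ℝ))⁻¹ * P.d = 1 / 2 := by
      field_simp
      ring
    rw [e]; linarith
  have h := cur_le_of_curlRow U hU hapos.le ha φ B hB hs hθ hwin hα
  rw [inv_inv] at h
  -- letters
  set K : ℝ := ∑ x : Site P i, ∑ μ : Fin P.d, ∑ ν : Fin P.d, (if μ < ν then
        ∑ j : Fin N, ∑ k : Fin N, ‖(curl (torusT P i) U (fun κ => covD (torusT P i) U κ φ) μ ν x) j k‖ ^ 2 else 0) with hK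
  set M : ℝ := ∑ x : Site P i, ∑ μ : Fin P.d, ∑ j : Fin N, ∑ k : Fin N, ‖(covD (torusT P i) U μ φ x) j k‖ ^ 2 with hM
  set CUR : ℝ := ∑ x : Site P i, ∑ μ : Fin P.d, ∑ j : Fin N, ∑ k : Fin N,
        ‖(∑ ν : Fin P.d,
            (R ((U ν (x.unshift ν))⁻¹ * plaqU (torusT P i) U ν μ (x.unshift ν) * U ν (x.unshift ν))
                  (R (U ν (x.unshift ν))⁻¹ (R (U μ (x.unshift ν) * U ν ((x.unshift ν).shift μ)) (φ (((x.unshift ν).shift μ).shift ν))))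
              - R (plaqU (torusT P i) U ν μ x)
                  (R (U ν (x.unshift ν))⁻¹ (R (U μ (x.unshift ν) * U ν ((x.unshift ν).shift μ)) (φ (((x.unshift ν).shift μ).shift ν)))))) j k‖ ^ 2 with hCUR
  clear_value K M CUR
  have e1 : (s * eK + s⁻¹ + 8 * a * (4 * a * (P.d : ℝ))) * K + (s * eM + 4 * a * P.d * (4 * a * (P.d : ℝ))) * M
      = (s * eK + s⁻¹ + 32 * a ^ 2 * P.d) * K + (s * eM / a ^ 2 + 16 * (P.d : ℝ) ^ 2) * a ^ 2 * M := by
    field_simp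
    ring
  rw [e1] at h
  have := mul_le_mul_of_nonneg_left h hw.le
  linarith [this]

/-! ## §3 E2E by kernel: (α) ⟹ ℛ-ROW★ -/

/-- ★★ **ℛ-ROW★ FROM THE CURL ROW OF THE CURRENT FIELD** — ✓ `RRow_of_JRow` ∘ §2: under §2's hypotheses plus `16a ≤ 1` and `0 ≤ e_K`,
`w·K(φ) ≤ (2C_J + C′a²w∕(2C_J) + 6d·a·w)·M(φ)` with `C_J = w·(s·e_K + s⁻¹ + 32a²d)`, `C′ = w·(s·e_M∕a² + 16d²)`.  (So the hKg-K chain ✓p686186 ∘ ✓p678151 reads ONE displayed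
analytic row (α) on the ℛ-line.) [cite: Balaban1985BackgroundPropagators, (3.9) p.392; Balaban1985Variational, (135) p.298, Prop. 7 p.299] -/
theorem RRow_of_curlRow [NeZero N] (hU : ∀ (ν : Fin P.d) (x : Site P i), (U ν x : Matrix (Fin N) (Fin N) ℂ) ∈ unitary (Matrix (Fin N) (Fin N) ℂ))
    {a : ℝ} (hapos : 0 < a) (ha : ∀ (μ ν : Fin P.d) (x : Site P i), ‖(plaqU (torusT P i) U μ ν x : Matrix (Fin N) (Fin N) ℂ) - 1‖ ≤ a) (ha16 : 16 * a ≤ 1) (hd : 0 < P.d)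
    (φ : Site P i → Matrix (Fin N) (Fin N) ℂ) (B : Fin P.d → Site P i → Matrix (Fin N) (Fin N) ℂ)
    (hB : ∀ (μ : Fin P.d) (x : Site P i), B μ x = ∑ ν : Fin P.d,
            (R ((U ν (x.unshift ν))⁻¹ * plaqU (torusT P i) U ν μ (x.unshift ν) * U ν (x.unshift ν))
                  (R (U ν (x.unshift ν))⁻¹ (R (U μ (x.unshift ν) * U ν ((x.unshift ν).shift μ)) (φ (((x.unshift ν).shift μ).shift ν))))
              - R (plaqU (torusT P i) U ν μ x)
                  (R (U ν (x.unshift ν))⁻¹ (R (U μ (x.unshift ν) * U ν ((x.unshift ν).shift μ)) (φ (((x.unshift ν).shift μ).shift ν))))))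
    {ρ eK eM w s : ℝ} (hw : 0 < w) (hs : 0 < s) (hsρ : 2 * s * ρ ≤ 1) (heK : 0 ≤ eK)
    (hα : ∑ x : Site P i, ∑ μ : Fin P.d, ∑ ν : Fin P.d, (if μ < ν then
        ∑ j : Fin N, ∑ k : Fin N, ‖(curl (torusT P i) U B μ ν x) j k‖ ^ 2 else 0)
      ≤ ρ * ∑ x : Site P i, ∑ μ : Fin P.d, ∑ j : Fin N, ∑ k : Fin N,
        ‖(∑ ν : Fin P.d,
            (R ((U ν (x.unshift ν))⁻¹ * plaqU (torusT P i) U ν μ (x.unshift ν) * U ν (x.unshift ν))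
                  (R (U ν (x.unshift ν))⁻¹ (R (U μ (x.unshift ν) * U ν ((x.unshift ν).shift μ)) (φ (((x.unshift ν).shift μ).shift ν))))
              - R (plaqU (torusT P i) U ν μ x)
                  (R (U ν (x.unshift ν))⁻¹ (R (U μ (x.unshift ν) * U ν ((x.unshift ν).shift μ)) (φ (((x.unshift ν).shift μ).shift ν)))))) j k‖ ^ 2
        + eK * ∑ x : Site P i, ∑ μ : Fin P.d, ∑ ν : Fin P.d, (if μ < ν then
        ∑ j : Fin N, ∑ k : Fin N, ‖(curl (torusT P i) U (fun κ => covD (torusT P i) U κ φ) μ ν x) j k‖ ^ 2 else 0)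
        + eM * ∑ x : Site P i, ∑ μ : Fin P.d, ∑ j : Fin N, ∑ k : Fin N, ‖(covD (torusT P i) U μ φ x) j k‖ ^ 2) :
    w * ∑ x : Site P i, ∑ μ : Fin P.d, ∑ ν : Fin P.d, (if μ < ν then
        ∑ j : Fin N, ∑ k : Fin N, ‖(curl (torusT P i) U (fun κ => covD (torusT P i) U κ φ) μ ν x) j k‖ ^ 2 else 0)
      ≤ (2 * (w * (s * eK + s⁻¹ + 32 * a ^ 2 * P.d)) + (w * (s * eM / a ^ 2 + 16 * (P.d : ℝ) ^ 2)) * a ^ 2 * w / (2 * (w * (s * eK + s⁻¹ + 32 * a ^ 2 * P.d)))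
            + 6 * P.d * a * w)
          * ∑ x : Site P i, ∑ μ : Fin P.d, ∑ j : Fin N, ∑ k : Fin N, ‖(covD (torusT P i) U μ φ x) j k‖ ^ 2 := by
  have hCJ : 0 < w * (s * eK + s⁻¹ + 32 * a ^ 2 * P.d) := by positivity
  exact RRow_of_JRow U hU hapos.le ha ha16 φ hCJ hw (JRow_of_curlRow U hU hapos ha hd φ B hB hw hs hsρ hα)

end Summit.QuantumFields.YangMills.Theorems.Prop7JRowOfCurlRow

end
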